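import Mathlib
import HarnessLib
import HarnessLib.Audit
import Summits.CriticalPhenomena.Statement

/-!
Route: PercPortalLadder

# Route PercPortalLadder — Perforating BGN's plane — the portal ladder from two glued critical
half-spaces (P = ∅, theorem) through a riveted grid (∃ k) and a same-p bridge to ℤ³ (P = ℤ², the
conjunct)

LADDER ROUTE (card CriticalPhenomena/PercolationContinuityZ3/perforated-bgn-plane-portal-ladder).
Cut ℤ³ between the layers
x₀ = 0 and x₀ = −1: H⁺ = {x₀ ≥ 0}, H⁻ = {x₀ ≤ −1}, joined by the vertical "portal" edges s(x, x −
e₀), x₀ = 0. For a portal set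
P ⊆ {x₀ = 0} let G_P := ℤ³ minus the portal edges NOT above P (so G_∅ = H⁺ ⊔ H⁻, G_{ℤ²} = ℤ³) and
let S(P) say: at p = p_c(ℤ³)
no vertex of G_P is in an infinite open cluster. S is antitone in P; S(∅) is Barsky–Grimmett–Newman
(PROVED in tree:
Literature.Probability.Percolation.BarskyGrimmettNewman1991_Z3_holds); S(univ) is θ_{ℤ³}(p_c) = 0 at
every vertex. It suffices
to show X = PortalLadder := S(P) for EVERY P — X is the conjunct in ladder form (its instance P =
univ), declared so. REPAIR
2026-08-16 (route-choice (a), operator hold target-unreachable): the ladder now reaches its top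
INSIDE the route, in the shape of
the sibling PercDivergentSlabLadder (ConeRung + LineConeRemoval): X ⟸ PortalGridRung ∧
GridWallPersistence through the glue item
PlaneOfPortalGrid, where PortalGridRung (crux, rank 5) = ∃ k ≥ 2, S(Π_k) for the square rivet grid
Π_k = {x₀ = 0, k ∣ x₁, k ∣ x₂}
— the first POSITIVE-DENSITY rung, implied by the conjunct — and GridWallPersistence (crux, rank 6)
= the same-p bridge
"θ_{ℤ³}(p_c) > 0 ⇒ every G_{Π_k}, k ≥ 1, percolates at p_c" (sealing one lattice plane except a
periodic rivet grid cannot destroy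
a critical infinite cluster; conjunct-adjacent, vacuous if θ(p_c) = 0, declared so). Below the top
the route's content is the
RUNGS, filed as ranked cruxes / supports: the sparse rungs are theorems-to-be (PortalSumCriterion,
FreeRung: unconditional), the
dilated-line and dimension rungs are conditional on boundary rates of BGN (BoundaryTwoPointDecay s >
1, QuantitativeBGN a > 0 — the
latter verbatim the decl of PercLowPointHalfSpace, shared), the undilated PortalLine is the first
rung beyond first moments, and
PortalGridRung the first rung whose infrared is not that of two free surfaces. Every rung is a
NECESSARY condition of the conjunct
(G_P ⊆ ℤ³); rung ∧ bridge is SUFFICIENT.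
Lean: `∀ P : Set (Literature.Probability.LatticeModels.Site 3), ∀ v :
Literature.Probability.LatticeModels.Site 3, Literature.Probability.Percolation.theta
((Literature.Probability.LatticeModels.zdGraph 3).deleteEdges {e | ∃ x :
Literature.Probability.LatticeModels.Site 3, x 0 = 0 ∧ x ∉ P ∧ e = s(x, x - Pi.single 0 1)}) v
(Literature.Probability.Percolation.criticalProbI 3) = 0`

## Assembly
Deciding theorem (glue.lean, planner Sketch2.lean rc 0): `closes : PortalGridRung →
GridWallPersistence → PlaneOfPortalGrid →
PercolationContinuityZ3` — the glue item gives X = PortalLadder, then instance P = Set.univ, v = 0: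
the wall {s(x, x − e₀) | x₀ = 0,
x ∉ univ} is ∅ (ext; simp), `SimpleGraph.deleteEdges_empty` returns zdGraph 3, and
PercolationContinuityZ3 unfolds to
θ (zdGraph 3) 0 (criticalProbI 3) = 0. PlaneOfPortalGrid itself (support, provable now) is the
contradiction at the rung's k plus
θ_{G_P} ≤ θ_{ℤ³} (delete-edges coupling) and translation invariance. The legacy item Assembly (X →
PercolationContinuityZ3, pure
logic) is kept. The lower rungs (ranks 2–4, supports) are milestones — each a necessary condition of
X, the sparse ones provable
now; the honest reading is still "BGN + how many doors": doors of dimension < 2x_h1 ≈ 1.95 are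
first-moment, the line is
amplitude-bound, the rivet grid is infrared-bound, and the bridge carries the same-p content that no
rung can.

Rationale: WHY THIS LINE. Mechanism (card): at p_c every H⁺- and H⁻-cluster is finite (BGN, in tree), so an
infinite cluster of G_P is an infinite CASCADE of
finite half-space pieces glued at open portals; along a self-avoiding piece path the H⁺ pieces are
distinct clusters of ONE
configuration (disjoint occurrence, vandenBergKestenJAP1985 / ReimerCPC2000), the H⁻ pieces
likewise, and H⁺, H⁻ and the portal
edges are independent — whence E[# piece paths of length n] ≤ (p_c · sup_x Σ_{y∈P∖x} τ∂(x,y))ⁿ with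
τ∂ the boundary two-point
function of the critical half-space (PortalSumCriterion). Correction to the card found while typing:
the natural kernel is τ∂
(decay r^{−2x_h1} ≈ r^{−1.95}, DengBlote2005 numerics), not the one-arm tail r^{−x_h1}: the
first-moment wall sits at portal
dimension 2x_h1 ≈ 1.95 — still below the plane (2), so the top rung stays non-perturbative, but
DILATED LINES kℤe₁ become rungs
under BoundaryTwoPointDecay(s > 1) (implied by a one-arm rate a > 1/2 via BK), and only the
undilated line is amplitude-bound.
Imported: branching-process / BK path counting (probability on graphs), 1D long-range percolation
for the line rung
(NewmanSchulman1986, AizenmanNewman1986, Berger2002, DuminilcopinGarbanTassion2024: s = 2x_h1 ∈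
(1,2) is Berger's continuity
regime, suggesting an openness-in-p proof of PortalLine that has no analogue for the plane).
Literature position:
IlievJansevanrensburgMadras2014 (arXiv:1406.6394, p.5) chart the defect-plane phase diagram OFF the
bulk-critical line and
write "it seems hard to say much about σ*(p_c(d))"; Zhang1994 settles the d = 2 analogue by RSW;
NewmanWu1997 the high-d
codimension ≥ 3 case; this route files the first statements ON the line p = p_c(ℤ³) for a perforated
separating plane. Versus
sibling routes: PercHalfSpace (closed) asked same-p transfer ⟺ conjunct; PercLowPointHalfSpace asks
three boundary exponents with
thresholds (5/2, 11/4, > 0); here any a > 0 / s > 1 buys rungs and the bottom is provable now.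
REPAIR 2026-08-16 (route-choice (a)): the top of the ladder is now filed — PortalGridRung (∃ k ≥ 2:
two BGN half-spaces riveted along the square grid Π_k = {x₀ = 0, k ∣ x₁, k ∣ x₂} do not percolate at
p_c; the first positive-density rung, beyond BK first moments at every k because dim Π_k = 2 >
2x_h1, and RG-relevantly coupled in the infrared, y = (d−1) − 2x_h1 ≈ +0.05 by Cardy1996 §7.2
counting) and the same-p bridge GridWallPersistence (θ_{ℤ³}(p_c) > 0 ⇒ every G_{Π_k} percolates: the
dilution-side twin of the NewmanWu1997 / IlievJansevanrensburgMadras2014 defect-plane question at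
bulk criticality, conjunct-adjacent and declared so), glued to the target by PlaneOfPortalGrid (pure
logic + θ_{G_P} ≤ θ_{ℤ³}); shape borrowed from the sibling PercDivergentSlabLadder (ConeRung +
LineConeRemoval), so the route now DECIDES the conjunct: closes : PortalGridRung →
GridWallPersistence → PlaneOfPortalGrid → PercolationContinuityZ3.

RANKED CRUXES. #0 PortalLadder (target) — X — for every portal set P ⊆ {x₀ = 0}, the perforated
lattice G_P = (zdGraph 3) minus the portal edges s(x, x − e₀) with x₀ = 0, x ∉ P has θ_{G_P}(v,
p_c(ℤ³)) = 0 at every vertex v. Instance P = univ (empty wall) is the conjunct at every vertex;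
instances P = ∅, sparse, line, dilated line are the rungs below. (why it might fail: It is the
conjunct in ladder form (false iff θ_{ℤ³}(p_c) > 0); since the 2026-08-16 repair it is reached
inside the route as PortalGridRung ∧ GridWallPersistence (glue PlaneOfPortalGrid) — one
positive-density rung plus a same-p bridge, NOT a limit P ↑ ℤ² (that would be constant-p_c
exhaustion / SlabLimitUniformControl).) [BarskyGrimmettNewman1991, Grimmett1999,
IlievJansevanrensburgMadras2014, arXiv:1401.7130]
#2 PortalLine (crux) — S(line): the two critical half-spaces glued through the portals above ONE
lattice line {x₀ = 0, x₂ = 0} do not percolate at p_c(ℤ³) (card Crux 1). The first rung beyond first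
moments: BK counting needs p_c·Σ_{j≠0} τ∂(0, j e₁) < 1, an amplitude nobody can certify
(heuristically ≈ 0.4); the soft engine is openness in p of cascade percolation along a line (a
Berger-type finite-size criterion for a DEPENDENT 1D long-range model with s = 2x_h1 ≈ 1.95 < 2)
plus trivial non-percolation of G_line at p < p_c. [difficulty: XL] (why it might fail: False only
with the conjunct (G_line ⊆ ℤ³). As a PROOF target: first moments hang on an uncertifiable
amplitude; the soft route needs Berger-type openness for a dependent 1D long-range model at s =
2x_h1 ≈ 1.95, next to the s = 2 discontinuity edge (AizenmanNewman1986).) [BarskyGrimmettNewman1991,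
Grimmett1999, NewmanSchulman1986, AizenmanNewman1986, Berger2002, DuminilcopinGarbanTassion2024,
IlievJansevanrensburgMadras2014, Zhang1994]
#3 BoundaryTwoPointDecay (crux) — boundary two-point decay with exponent > 1: ∃ s > 1, C with
P_{p_c}(0 ↔ y inside H⁺) ≤ C·|y|_∞^{−s} for floor points y ≠ 0 (numerically s = 2x_h1 ≈ 1.95;
implied by a boundary one-arm rate a > 1/2 via BK; the exact input that makes dilated lines and
every dilated portal set of dimension < s a first-moment rung). [difficulty: XL] (why it might fail:
No rate of any kind is known for BGN (critical half-space clusters are finite by contradiction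
through a finite-size criterion, Grimmett1999 pp.163–169); s > 1 means x_h1 > 1/2 vs the measured
0.975 (DengBlote2005): margin fine, technology (multi-scale steering / boundary Simon–Lieb at p_c)
absent.) [BarskyGrimmettNewman1991, Grimmett1999, DengBlote2005, arXiv:1810.03750, KozmaNitzan2024]
#4 QuantitativeBGN (crux) — quantitative Barsky–Grimmett–Newman: at p_c(ℤ³) the boundary one-arm
probability P(C_H(0) reaches sup-distance ≥ r) ≤ C r^{−a} for SOME a > 0 (numerically a = x_h1 ≈
0.975). Verbatim the decl QuantitativeBGN of route PercLowPointHalfSpace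
(stmt-CriticalPhenomena-0913; shared item): here any a > 0 buys the dimension rung (portal sets that
are 2a-sparse), a > 1/2 buys BoundaryTwoPointDecay. [difficulty: XL] (why it might fail: BGN
(Grimmett1999 Thm 7.35) is qualitative ({θ_H > 0} is open via a finite-size criterion); no rate in
print for d = 3 (KozmaNitzan2024 p.2; ChatterjeeHanson n^{−3} needs d ≥ 11); a power law needs a
scale-uniform half-space crossing bound < 1 at p_c(ℤ³), an RSW-type input unknown in 3D.)
[Grimmett1999, BarskyGrimmettNewman1991, arXiv:1810.03750, KozmaNitzan2024, NewmanTassionWu2017,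
doi:10.1103/PhysRevE.71.016117]
#5 PortalGridRung (crux) — THE GRID RUNG, top filed rung: ∃ k ≥ 2 with S(Π_k), Π_k = {x₀ = 0, k ∣
x₁, k ∣ x₂} — two critical half-spaces riveted along a sparse square grid do not percolate at
p_c(ℤ³). Implied by the conjunct; implies the k-dilated line rung; the first positive-density portal
set: Σ_{Π_k} τ∂ = ∞ at every k (dim 2 > 2x_h1 ≈ 1.95, χ₁₁(p_c) = ∞) so PortalSumCriterion never
applies, although BK counting still forbids crossing cascades below an astronomically large scale
(R/k ≈ (k^{1.95}/(cA))^{20}, c = O(10²), A the boundary amplitude); decided in the deep infrared,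
where the rivet sheet is RG-relevant (y ≈ +0.05). [difficulty: open-problem] (why it might fail:
Implied by the conjunct; false only with it. As a target: BK first moments fail at every k and the
infrared is bulk-coupled, not BGN-like; engines (openness of rivet-cascade percolation; quenched
repulsion of distinct boundary pieces) unbuilt.) [BarskyGrimmettNewman1991, Grimmett1999,
DengBlote2005, Cardy1996, IlievJansevanrensburgMadras2014, NewmanWu1997, vandenBergKestenJAP1985]
#6 GridWallPersistence (crux) — THE SAME-p BRIDGE (conjunct-adjacent, declared so; shape of
PercDivergentSlabLadder.LineConeRemoval): θ_{ℤ³}(0, p_c) > 0 ⇒ ∀ k ≥ 1 ∃ v, θ_{G_{Π_k}}(v, p_c) > 0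
— sealing all crossing edges of one lattice plane except a periodic positive-density rivet grid
cannot destroy a critical infinite cluster. Vacuous if θ(p_c) = 0; trivial for p > p_c (G_{Π_k} ⊇
H⁺, p_c(H) = p_c); at p_c it is the dilution-side twin of 'σ*(p_c(d)) vs p_c(d)'
(IlievJansevanrensburgMadras2014 p.5: hard to say much; NewmanWu1997: enhancement side settled for
large d, codim ≥ 3, conjectured for 2 ≤ s < d — that side is STRONGER than the conjunct, this decl
is implied by it). [difficulty: open-problem] (why it might fail: Vacuous iff θ(p_c) = 0; otherwise
it forbids a defect transition AT bulk criticality, which nothing excludes: plane-weakening is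
RG-relevant at the homogeneous point (y = 1/ν − 1 ≈ +0.14), density-zero deletions CAN kill critical
clusters (route PercDustSandwich (a)), Aizenman–Grimmett is void (p_c(G_{Π_k}) = p_c), mass
transport is blind (AmenableInvariantPercolation).) [IlievJansevanrensburgMadras2014, NewmanWu1997,
Zhang1994, AizenmanGrimmett1991, BarskyGrimmettNewman1991, GrimmettMarstrand1990,
WangZhouZhangGaroniDeng2013]
#9 PortalSumCriterion (support) — the cascade lemma in criterion form (card Crux 3, corrected
kernel): for P ⊆ {x₀ = 0}, if sup_{x∈P} Σ_{y∈P∖{x}} τ∂(x,y) ≤ 1/2 (all finite partial sums) then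
S(P). Proof: BGN at every boundary point of H⁺ and H⁻ (translation/reflection symmetry) makes all
pieces finite ⇒ an infinite cluster contains an infinite self-avoiding piece path (König); distinct
same-side pieces occur disjointly (BK by finite approximation), sides and portals independent ⇒ E[#
paths of length n] ≤ A_v (p_c/2)^{n−1} → 0. Lean size L. [difficulty: provable-now]
[vandenBergKestenJAP1985, ReimerCPC2000, BarskyGrimmettNewman1991, Grimmett1999]
#9 FreeRung (support) — the free rung (card): there is an INFINITE portal set P ⊆ {x₀ = 0} with S(P)
— unconditionally. Proof: τ∂(0, ±n e₁) → 0 (BGN + continuity of measure, the floor analogue of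
PercLowPointHalfSpace.HalfSpaceAxisDecay), so a greedy sequence kₙe₁ with fast-growing gaps meets
PortalSumCriterion (row sums ≤ 1/4 + 1/4). The first 'BGN + ε' theorem: two critical half-spaces
glued through infinitely many doors still do not percolate. [difficulty: provable-now]
[BarskyGrimmettNewman1991, Grimmett1999, vandenBergKestenJAP1985]
#9 DilatedLineRung (support) — glue for the line: BoundaryTwoPointDecay ⇒ ∃ k₀, ∀ k ≥ k₀, S(kℤ e₁)
(portals above the multiples of k on the line): row sums Σ_{j≠0} C|jk|^{−s} = 2Cζ(s)k^{−s} ≤ 1/2 for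
k ≥ k₀, then PortalSumCriterion (translation invariance of τ∂ along e₁). [difficulty: provable-now]
[BarskyGrimmettNewman1991, DengBlote2005, vandenBergKestenJAP1985]
#9 DimensionRung (support) — glue for the card's dimension rungs: QuantitativeBGN ⇒ ∃ a, ε > 0 such
that every P ⊆ {x₀ = 0} that is a-sparse (sup_{x∈P} Σ_{y∈P∖{x}} |x−y|_∞^{−a} ≤ ε) has S(P). Proof:
τ∂(x,y) ≤ P(arm(x,⌊d/2⌋) ∘ arm(y,⌊d/2⌋)) ≤ C² 3^{2a} d^{−2a} by BK (initial and final path segments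
are edge-disjoint), then PortalSumCriterion with ε = 1/(2 max(1, C² 9^a)). All portal sets of upper
Minkowski dimension < a qualify after dilation. [difficulty: provable-now]
[BarskyGrimmettNewman1991, vandenBergKestenJAP1985, ReimerCPC2000, Grimmett1999]
#9 PlaneOfPortalGrid (support) — GLUE cruxes → target (route-choice repair 2026-08-16; clears
`route.target-unreachable`): PortalGridRung → GridWallPersistence → PortalLadder, by name. Proof:
contradiction at the rung's k ≥ 2 ≥ 1 gives θ_{ℤ³}(0, p_c) = 0 (θ ≥ 0); then θ_{G_P}(v, p_c) ≤
θ_{ℤ³}(v, p_c) = θ_{ℤ³}(0, p_c) = 0 by translation invariance (theta_zdGraph_eq_theta_zero) and the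
delete-edges coupling ω ↦ ω ∩ E(G_P) (setBernoulli_map_inter; percolatesAt monotone in ω). Planner
check Sketch2.lean rc 0 modulo the coupling lemma. [difficulty: provable-now] [Grimmett1999,
BarskyGrimmettNewman1991]

TWO-LAYER PLAN. Foreseen glued splits (none filed now). PortalLine ⇐ LineOpenness → LineSubcritical
→ PortalLine: LineOpenness = "{p : G_line has an
infinite cluster} is open" (a finite-size criterion for cascade percolation ALONG A LINE,
Berger2002-type renormalisation for a
dependent 1D long-range model with s < 2), LineSubcritical = "G_line does not percolate at any p <
p_c" (exponential decay in H^±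
below p_c(H) = p_c makes the line a 1D system with summable long connections; provable now), glue =
contradiction at p_c. This is
BGN's own strategy one dimension down, and it has no analogue for the plane (there openness IS
Grimmett–Marstrand without
sprinkling). QuantitativeBGN ⇐ (scale-uniform half-space crossing bound) → (multi-scale steering):
shared item, decomposed by
PercLowPointHalfSpace's tenure. PortalGridRung ⇐ GridOpenness → PortalGridRung (k ≤ 3, depth 1; not
filed): GridOpenness = "for some k ≥ 2 the set {p : G_{Π_k} has an infinite cluster} is open" —
BGN's finite-size-criterion-plus-steering scheme for rivet cascades (steer inside H^± between
rivets, renew at rivets); the glue is free: θ_{G_{Π_k}}(p) ≤ θ_{ℤ³}(p) = 0 for p < p_c = p_c(H), so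
openness at p_c forces S(Π_k). This is LineOpenness one dimension up and meets
SprinklingRenormalisation head-on (for P = ℤ² openness IS Grimmett–Marstrand without sprinkling);
the rivet spacing k is the only new small parameter (cascade subcritical below scale R(k)).
GridWallPersistence is not decomposed (no engine; a same-p statement). Beyond: Bernoulli rivets /
denser grids add nothing new (all dimension-2 portal sets share the bulk-coupled infrared); the
critical-cascade (m = 1) extinction theorem of card plane-cut-two-partitions, if it ever opens as a
route, would supersede the top (superseded --by), not extend this file.

KILL CRITERIA. No rung can be refuted without refuting the conjunct: ¬S(P) for any P gives an
infinite critical cluster of G_P ⊆ ℤ³, i.e.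
θ_{ℤ³}(p_c) > 0 — close the route AND record the summit's negative resolution. BoundaryTwoPointDecay
/ QuantitativeBGN cannot be
refuted short of θ_H(p_c) > 0 (impossible: BGN proved); they die only as 'no rate provable', which
is not a refutation — if a
tenure cycle finds them dormant, the route contracts to PortalSumCriterion + FreeRung + PortalLine.
The LINE OF ATTACK is killed if
(i) PortalSumCriterion is refuted as typed (a BK/measurability slip in the constant 1/2 — then
restate with the correct constant;
the qualitative content survives any constant), or (ii) a refuter shows the corrected wall wrong,
i.e. that BK path counting cannot
use τ∂ (it can: distinct pieces are vertex-disjoint). Superseded if a plane-cut-two-partitions route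
opens with a 2D theorem whose
special cases are these rungs. The 2026-08-16 top: PortalGridRung and GridWallPersistence can each
be refuted only together with θ_{ℤ³}(p_c) > 0 (the summit's negative resolution: record it and
close); they die otherwise only as 'no engine', which is dormancy, not refutation — then the route
contracts to its rungs and goes back to the operator as a ladder without a top (retire or
re-bridge). The repair itself is undone if PlaneOfPortalGrid is shown unprovable as typed (it is
pure logic + the delete-edges coupling; a typing slip in Π_k or the wall orientation would be
restated 1:1).

NOT DECOMPOSED YET. The internals of PortalSumCriterion (piece graph, König's lemma, multi-event BK
by finite-volume approximation, transport of
BarskyGrimmettNewman1991_Z3_holds to every boundary point of H⁺ and, by the reflection x₀ ↦ −1 − x₀,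
to H⁻); FloorAxisDecay
(τ∂(0, ±n e₁) → 0, the input of FreeRung — ~40 lines like HalfSpaceAxisDecay); the value of k₀ in
DilatedLineRung; the LRP
renormalisation for PortalLine (layer-2 children above); the internals of PortalGridRung
(GridOpenness above; the finite-volume statement 'no rivet cascade crosses scale R(k)', which IS
first-moment and could be filed as a support milestone by tenure); GridWallPersistence (deliberately
atomic); Bernoulli-rivet and line-lattice variants of the top (same infrared, not filed). Prior
programme: not consulted (plancard / route-choice modes).

CHEAPEST FALSIFIER. Two lookups and one number. (a) The wall: the boundary two-point exponent along
the floor is 2x_h1 with x_h1 = 2 − y_h1 ≈ 0.975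
(DengBlote2005, quoted from the cards; the paper is paywalled here, acq-01316) — a refuter who finds
2x_h1 ≤ 1 kills
BoundaryTwoPointDecay and DilatedLineRung (absurd numerically); one who finds 2x_h1 > 2 makes the
TOP rung first-moment modulo
amplitude and the route should pivot to certifying Σ_y τ∂(0,y) < 1/p_c. (b) Literature: does MSS94 /
NewmanWu1997 / IJvRM 2014
already contain S(P) for periodic sparse P at p = p_c(ℤ³)? (IJvRM p.5 says the critical line is
untouched; not found.) (c) A kit
Monte Carlo of p_c·Σ_{0<|j|≤128} τ∂(0, j e₁) at p = 0.2488 in 256²×128 half-boxes: ≈ 0.4 expected; a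
value ≥ 1 would move
PortalLine firmly into renormalisation territory, ≪ 1 says its only obstruction is rigour of an
amplitude. (d) For the 2026-08-16 top, a lookup: any printed statement deciding S(Π_k) (or any
positive-density periodic perforation of one plane) at p = p_c(ℤ³) either way — IJvRM p.5 and the
NewmanWu1997 review say the bulk-critical line is untouched (NewmanWu1997 itself is paywalled here,
acq-01509); and a typing check of Π_k = {k ∣ x₁ ∧ k ∣ x₂} (k = 1 gives the empty wall, k = 0 a
single rivet — excluded by 2 ≤ k in the rung and 1 ≤ k in the bridge).

NUMBERS. p_c(ℤ³, bond) = 0.2488126(5) (Wang–Zhou–Zhang–Garoni–Deng, PRE 87 (2013) 052107, as cited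
in arXiv:1406.6394). Surface magnetic
exponent of 3D percolation (ordinary transition) x_h1 = 2 − y_h1 ≈ 0.975 (DengBlote2005 =
doi:10.1103/PhysRevE.71.016117, quoted
via cards lowpoint-identity / perforated-bgn; not re-read). Kernels: one-arm g(r) ~ r^{−0.975},
boundary two-point τ∂(r) ~
r^{−1.95}; row sums Σ_{y∈P} τ∂ converge iff dim P < 1.95: line 1 < 1.95 (converges), plane 2 > 1.95
(diverges: χ₁₁ = ∞, γ₁₁ ≈
+0.04). Thresholds asked: s > 1 (BoundaryTwoPointDecay), a > 0 (QuantitativeBGN); a > 1/2 ⇒ s = 2a >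
1 by BK. Mean field (d > 6):
x_h1 = 3, wall at dimension 6 > d − 1 — the whole plane is first-moment there (cf. NewmanWu1997). RG
eigenvalues used in the why-might-fails (scaling counting x_s = d − 1 − y_s, Cardy1996 (7.9), γ₁₁ =
(d−1−2x_{h,s})/y_t p.124): rivet-sheet coupling at the cut y = (d−1) − 2x_h1 ≈ 2 − 1.95 = +0.05
(relevant, barely); plane-weakening at the homogeneous critical point y = y_t − 1 = 1/ν − 1 ≈ 1.141
− 1 = +0.14 (relevant; y_t from WangZhouZhangGaroniDeng2013); 2D sanity check y = 3/4 − 1 < 0 and 1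
− 2/3 > 0 (single flow cut → homogeneous, consistent with Zhang1994). First-moment window of the
grid: R(k)/k ≈ (k^{1.95}/(cA))^{20}. Items at open: 9 (1 target, 3 cruxes, 4 supports, 1 assembly);
after the 2026-08-16 repair: 12 (1 target, 5 cruxes, 5 supports, 1 assembly).

DEFINITION REQUESTS. None filed: every decl is a one-line Prop over existing declarations (theta,
bondPercolation, openConnIn, criticalProbI, zdGraph,
SimpleGraph.deleteEdges, Pi.single, dist). A prover-side abbreviation `portalGraph P := (zdGraph
3).deleteEdges {s(x, x −
Pi.single 0 1) | x 0 = 0, x ∉ P}` and `bdryTau x y := (bondPercolation (zdGraph 3) (criticalProbI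
3)).real (openConnIn {z | 0 ≤
z 0} x y)` in the prover's own Theorems file would shorten every rung; no Literature notion is
missing. Fact wanted as hypothesis
by nobody new: BGN is proved in tree.

Novelty: Searches (2026-08-15): `lit galaxy search "percolation in half-spaces" --star all` (3 pdf hits:
brochette percolation
DHKS 2018; Sá 2019 UFMG thesis; de Lima et al. doi:10.30757/ALEA.v19-67 sublattice of defects); `lit
search --source crossref
"inhomogeneous percolation defect plane critical"` (15: doi:10.1007/s10955-014-1125-5,
doi:10.1214/aop/1176988730,
doi:10.1103/physrevb.40.5187 relevant); `lit read arXiv:1406.6394 --grep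
theorem|conjecture|half-space` (175 lines; pp.4–6 read);
`lit vsearch "<thesis in prose>"` (10 textbook hits, none specific); `lit galaxy search "defect
plane" --star all` (30 rows:
materials-science noise + 3D O(N) plane-defect physics arXiv:2303.16683); local hybrid index:
searchd connection reset
(unavailable 11:27Z); arXiv API 429; `ledger negatives` (1 refuted statement, SAW, unrelated);
sibling routes and 130 cards of the
sub read by title, plane-cut-two-partitions and lowpoint-identity in full.
Nearest prior art found: IlievJansevanrensburgMadras2014 (arXiv:1406.6394: defect-plane phase
diagram for p ≠ p_c(d); p.5 "it
seems hard to say much about σ*(p_c(d))"), Zhang1994 (d = 2 analogue solved by RSW), NewmanWu1997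
(codimension ≥ 3, high d),
BarskyGrimmettNewman1991 = Grimmett1999 Thm (7.35) + p.163 (rung P = ∅ and the weaving remark),
in-house cards
plane-cut-two-partitions (top rung with Bernoulli glue; critical cascade m = 1) and
lowpoint-identity-halfspace-pinned-pairs
(QuantitativeBGN, x_h1 numerology).
Delta: the first statements ON the bul  [refs: 10.30757/ALEA.v19-67, 10.1007/s10955-014-1125-5, 10.1214/aop/1176988730, 10.1103/physrevb.40.5187, 1406.6394, 2303.16683, doi:10.30757/ALEA.v19-67, doi:10.1007/s10955-014-1125-5, doi:10.1214/aop/1176988730, doi:10.1103/physrevb.40.5187, IlievJansevanrensburgMadras2014, Zhang1994, NewmanWu1997, BarskyGrimmettNewman1991, Grimmett1999]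

Barriers (technique_class: perforated-plane, halfspace-cascade, BK-disjointness): - technique_class: perforated-plane, halfspace-cascade, BK-disjointness
- Literature.Barriers.CriticalPhenomena.SprinklingRenormalisation: evaded on every filed rung — no
parameter moves, no block is renormalised: BK + independence of H⁺/H⁻/portals + union bounds AT p_c;
it re-enters only in the layer-2 plan for PortalLine (openness of cascade percolation along a line),
where the bet is that 1D long-range technology (Berger2002) replaces sprinkling; for the plane it is
not evaded and not attempted.
- Literature.Barriers.CriticalPhenomena.LongRangeDiscontinuity: engaged as a concrete sub-model, not
an analogy — the line rung is a dependent 1D long-range percolation with s = 2x_h1 ≈ 1.95 ∈ (1, 2),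
inside Berger's continuity regime and next to the s = 2 edge where AizenmanNewman1986's
discontinuity witness lives; hence PortalLine admits no exponent-only proof and its why-might-fail
says so; the barrier's witnesses (1/r² models) are not Bernoulli n.n. on ℤ³ and do not bear on the
statements, only on methods.
- Literature.Barriers.CriticalPhenomena.SlabLimitUniformControl: not engaged and deliberately so —
no rung is passed to a limit in P; the top rung is filed as the target itself (declared
conjunct-equivalent), never derived from the rungs (that derivation would be constant-p_c
exhaustion, card constant-pc-exhaustion-witness).
- Literature.Barriers.CriticalPhenomena.TransverseCrossingsNeedNotMeet: not engaged — cascades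
concatenate at shared portal VERTICES; disjointness of dis

History (route lifecycle, newest last):
- 2026-08-29T05:46:41Z · DORMANT — reconciler: no traction for 5.1 d (last activity statement-closed at 2026-08-24T02:12:44Z); parked, not closed — `ledger route dormant route-CriticalPhenomena-P (operator:999:1121247)
- 2026-08-29T11:33:16Z · REACTIVATED — reconciler: reactivated — activity statement-checked at 2026-08-29T10:21:03Z after parking at 2026-08-29T05:46:41Z (operator:999:2011046)

sub-problem: PercolationContinuityZ3 · status: open · opened planner-plancard-CriticalPhenomena-Percolatio-f724364a-0 2026-08-15T11:45:20Z · rev 4 · ledger route-CriticalPhenomena-PercPortalLadder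
GENERATED by the gate from the ledger (D-0016/17). Provers cite these decls: `theorem foo : Summit.CriticalPhenomena.PercolationContinuityZ3.Theses.PercPortalLadder.<Decl> := …` in Summits/CriticalPhenomena/PercolationContinuityZ3/Theorems/<Name>.lean.
-/

namespace Summit.CriticalPhenomena.PercolationContinuityZ3.Theses.PercPortalLadder

open scoped BigOperators Topology Manifold Classical MeasureTheory ProbabilityTheory Matrix InnerProductSpace ComplexConjugate ContinuousMap
open Filter Set Function TopologicalSpace MeasureTheory

attribute [summit_statement] _root_.PercolationContinuityZ3

/-- item stmt-CriticalPhenomena-6257 · target · rank 0 · closed · proved by Summit.CriticalPhenomena.PercolationContinuityZ3.Theorems.PercPortalLadderPortalLadder.portalLadder_proof @ 4e72ed05b746 (prover) · by planner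
why it might fail: Conjunct-equivalent: instance P = univ, v = 0 IS θ_{ℤ³}(p_c)=0 (closes uses it alone); false iff θ_{ℤ³}(p_c)>0, open since Grimmett1999 §8. NOT derived from the rungs: the limit P↑ℤ² is constant-p_c exhaustion (SlabLimitUniformControl; slab constants of arXiv:1401.7130 degenerate as k→∞).
sources: Grimmett1999, BarskyGrimmettNewman1991, FitznerVanDerHofstad2017, IlievJansevanrensburgMadras2014, arXiv:1401.7130
[target] X — for every portal set P ⊆ {x₀ = 0}, the perforated lattice G_P = (zdGraph 3) minus the
portal edges s(x, x − e₀) with x₀ = 0, x ∉ P has θ_{G_P}(v, p_c(ℤ³)) = 0 at every vertex v. Instance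
P = univ (empty wall) is the conjunct at every vertex; instances P = ∅, sparse, line, dilated line
are the rungs below. -/
@[route_item "route-CriticalPhenomena-PercPortalLadder"]
def PortalLadder : Prop :=
  ∀ P : Set (Literature.Probability.LatticeModels.Site 3), ∀ v : Literature.Probability.LatticeModels.Site 3, Literature.Probability.Percolation.theta ((Literature.Probability.LatticeModels.zdGraph 3).deleteEdges {e | ∃ x : Literature.Probability.LatticeModels.Site 3, x 0 = 0 ∧ x ∉ P ∧ e = s(x, x - Pi.single 0 1)}) v (Literature.Probability.Percolation.criticalProbI 3) = 0

-- `PortalLadder` holds: proved by `Summit.CriticalPhenomena.PercolationContinuityZ3.Theorems.PercPortalLadderPortalLadder.portalLadder_proof` @ 4e72ed05b746 (its module imports this route file, so no `_holds` link can be stated here).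

/-- item stmt-CriticalPhenomena-14516 · crux · rank 5 · closed · proved by Summit.CriticalPhenomena.PercolationContinuityZ3.Theorems.PercPortalLadderPortalGridRung.portalGridRung_proof @ 7974026f4dee (prover) · by planner
why it might fail: Implied by the conjunct; false only with it. As a target: dim Π_k = 2 > 2x_h1 ≈ 1.95 gives Σ_{Π_k}τ∂ = ∞ (χ₁₁(p_c) = ∞, DengBlote2005), so BK first moments fail at every k, and the rivet sheet is RG-relevant (y = 2 − 2x_h1 ≈ +0.05): the infrared is not BGN-like; no engine in print.
sources: BarskyGrimmettNewman1991, Grimmett1999, DengBlote2005, Cardy1996, IlievJansevanrensburgMadras2014, NewmanWu1997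
[crux] THE GRID RUNG (top filed rung of the ladder; the first POSITIVE-DENSITY portal set;
route-choice repair 2026-08-16): there is a spacing k ≥ 2 such that the two critical half-spaces H⁺
= {x₀ ≥ 0}, H⁻ = {x₀ ≤ −1} glued ONLY through the portal edges s(x, x − e₀) above the square grid
Π_k = {x₀ = 0, k ∣ x₁, k ∣ x₂} do not percolate at p_c(ℤ³): θ_{G_{Π_k}}(v, p_c) = 0 at every vertex
v (two BGN half-spaces riveted along a sparse periodic grid still do not percolate). Implied by the
conjunct (G_{Π_k} ⊆ ℤ³); implies the k-dilated line rung S(kℤe₁) by monotonicity in P (Π_k ⊇ {x₂ =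
0, k ∣ x₁}). Position on the ladder: dim Π_k = 2 > 2x_h1 ≈ 1.95, so Σ_{y∈Π_k} τ∂(0,y) = ∞ (χ₁₁(p_c)
= ∞, γ₁₁ = ν(d−1−2x_h1) ≈ +0.04: Cardy1996 §7.2 p.124 scaling with DengBlote2005 exponents) and
PortalSumCriterion never applies; yet the divergence is so slow (partial sums ∝
k^{−1.95}(R/k)^{0.05}) that BK cascade counting rules out crossing cascades below an astronomically
large scale R(k) (≈ k·(k^{1.95}/(31A))^{20} for boundary amplitude A), so the rung is decided
entirely in the deep infrared, where the rivet sheet is an RG-RELEVANT coupling of the two surfaces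
(eigenvalue (d−1) − 2x_h1 ≈ +0.05) — physi -/
@[route_item "route-CriticalPhenomena-PercPortalLadder"]
def PortalGridRung : Prop :=
  ∃ k : ℕ, 2 ≤ k ∧ ∀ v : Literature.Probability.LatticeModels.Site 3, Literature.Probability.Percolation.theta ((Literature.Probability.LatticeModels.zdGraph 3).deleteEdges {e | ∃ x : Literature.Probability.LatticeModels.Site 3, x 0 = 0 ∧ x ∉ {y : Literature.Probability.LatticeModels.Site 3 | (k : ℤ) ∣ y 1 ∧ (k : ℤ) ∣ y 2} ∧ e = s(x, x - Pi.single 0 1)}) v (Literature.Probability.Percolation.criticalProbI 3) = 0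

-- `PortalGridRung` holds: proved by `Summit.CriticalPhenomena.PercolationContinuityZ3.Theorems.PercPortalLadderPortalGridRung.portalGridRung_proof` @ 7974026f4dee (its module imports this route file, so no `_holds` link can be stated here).

/-- item stmt-CriticalPhenomena-14517 · crux · rank 6 · closed · proved by Summit.CriticalPhenomena.PercolationContinuityZ3.Theorems.PercPortalLadderGridWallPersistence.gridWallPersistence_proof @ 3ef87ec25ca5 (prover) · by planner
why it might fail: Vacuous iff θ(p_c)=0; otherwise it forbids a defect transition AT bulk criticality, which nothing excludes: plane-weakening is RG-relevant (y = 1/ν − 1 ≈ +0.14), density-zero deletions CAN kill critical clusters (PercDustSandwich), AG is void (p_c unmoved), MTP is blind.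
sources: IlievJansevanrensburgMadras2014, NewmanWu1997, Zhang1994, AizenmanGrimmett1991, BarskyGrimmettNewman1991, GrimmettMarstrand1990
[crux] GRID-WALL PERSISTENCE (the same-p bridge to the target; conjunct-adjacent and declared so —
shape of PercDivergentSlabLadder.LineConeRemoval; route-choice repair 2026-08-16): if θ_{ℤ³}(0, p_c)
> 0 then for EVERY spacing k ≥ 1 some vertex of G_{Π_k} = ℤ³ minus the crossing edges s(x, x − e₀),
x₀ = 0, x ∉ Π_k percolates at p_c — sealing all the crossing edges of ONE lattice plane except a
periodic positive-density grid of rivets cannot destroy a critical infinite cluster. Vacuous if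
θ(p_c) = 0; trivially true at every p > p_c (G_{Π_k} ⊇ H⁺ and p_c(H) = p_c:
BarskyGrimmettNewman1991, GrimmettMarstrand1990); at p = p_c it is the DILUTION-side twin of the
defect-plane question at bulk criticality that the literature leaves open:
IlievJansevanrensburgMadras2014 (arXiv:1406.6394 p.5: 'it seems hard to say much about σ*(p_c(d))';
proving σ*(p_c(d)) > p_c(d) 'would imply the longstanding conjecture'), NewmanWu1997 (large d, 2 ≤ s
≤ d−3: p_c(s) > σ*(p_c(d)) > p_c(d), conjectured for all 2 ≤ s < d — the ENHANCEMENT side, which is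
stronger than the conjunct, whereas this decl is implied by it), Zhang1994 (d = 2 by RSW). Its
negation is a defect transition AT bulk criticality driven by a -/
@[route_item "route-CriticalPhenomena-PercPortalLadder"]
def GridWallPersistence : Prop :=
  0 < Literature.Probability.Percolation.theta (Literature.Probability.LatticeModels.zdGraph 3) 0 (Literature.Probability.Percolation.criticalProbI 3) → ∀ k : ℕ, 1 ≤ k → ∃ v : Literature.Probability.LatticeModels.Site 3, 0 < Literature.Probability.Percolation.theta ((Literature.Probability.LatticeModels.zdGraph 3).deleteEdges {e | ∃ x : Literature.Probability.LatticeModels.Site 3, x 0 = 0 ∧ x ∉ {y : Literature.Probability.LatticeModels.Site 3 | (k : ℤ) ∣ y 1 ∧ (k : ℤ) ∣ y 2} ∧ e = s(x, x - Pi.single 0 1)}) v (Literature.Probability.Percolation.criticalProbI 3)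

-- `GridWallPersistence` holds: proved by `Summit.CriticalPhenomena.PercolationContinuityZ3.Theorems.PercPortalLadderGridWallPersistence.gridWallPersistence_proof` @ 3ef87ec25ca5 (its module imports this route file, so no `_holds` link can be stated here).

/-- item stmt-CriticalPhenomena-6258 · banked · rank 2 · closed · proved by Summit.CriticalPhenomena.PercolationContinuityZ3.Theorems.PortalLadderPortalLine.portalLine_proof @ abcbfe837674 (prover) · by planner
why it might fail: False only with the conjunct (G_line ⊆ ℤ³). As the attack: BK first moments need the uncertifiable amplitude p_c·Σ_{j≠0}τ∂(0,je₁)<1; the soft route needs Berger2002 Thm 1.5-type openness for a DEPENDENT 1D long-range model at s=2x_h1≈1.95, beside the s=2 discontinuity (AizenmanNewman1986).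
sources: Berger2002, AizenmanNewman1986, NewmanSchulman1986, DuminilcopinGarbanTassion2024, BarskyGrimmettNewman1991, Grimmett1999
[crux] S(line): the two critical half-spaces glued through the portals above ONE lattice line {x₀ =
0, x₂ = 0} do not percolate at p_c(ℤ³) (card Crux 1). The first rung beyond first moments: BK
counting needs p_c·Σ_{j≠0} τ∂(0, j e₁) < 1, an amplitude nobody can certify (heuristically ≈ 0.4);
the soft engine is openness in p of cascade percolation along a line (a Berger-type finite-size
criterion for a DEPENDENT 1D long-range model with s = 2x_h1 ≈ 1.95 < 2) plus trivial
non-percolation of G_line at p < p_c. [difficulty: XL] -/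
@[route_item "route-CriticalPhenomena-PercPortalLadder"]
def PortalLine : Prop :=
  ∀ v : Literature.Probability.LatticeModels.Site 3, Literature.Probability.Percolation.theta ((Literature.Probability.LatticeModels.zdGraph 3).deleteEdges {e | ∃ x : Literature.Probability.LatticeModels.Site 3, x 0 = 0 ∧ x ∉ {y : Literature.Probability.LatticeModels.Site 3 | y 2 = 0} ∧ e = s(x, x - Pi.single 0 1)}) v (Literature.Probability.Percolation.criticalProbI 3) = 0

-- `PortalLine` holds: proved by `Summit.CriticalPhenomena.PercolationContinuityZ3.Theorems.PortalLadderPortalLine.portalLine_proof` @ abcbfe837674 (its module imports this route file, so no `_holds` link can be stated here).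

/-- item stmt-CriticalPhenomena-6259 · aside · rank 3 · open · by planner
why it might fail: No rate in print for BGN at d=3: Grimmett1999 Thm 7.35 is qualitative (finite-size criterion, by contradiction); ChatterjeeHanson2020 Thm 1(b): s=d only for d≥11. s>1 needs x_h1>1/2 (s=2x_h1; measured x_h1≈0.975, DengBlote2005): margin wide, but no multi-scale/boundary Simon–Lieb tool at p_c.
sources: Grimmett1999, BarskyGrimmettNewman1991, DengBlote2005, ChatterjeeHanson2020, arXiv:1810.03750, KozmaNitzan2024
[crux] boundary two-point decay with exponent > 1: ∃ s > 1, C with P_{p_c}(0 ↔ y inside H⁺) ≤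
C·|y|_∞^{−s} for floor points y ≠ 0 (numerically s = 2x_h1 ≈ 1.95; implied by a boundary one-arm
rate a > 1/2 via BK; the exact input that makes dilated lines and every dilated portal set of
dimension < s a first-moment rung). [difficulty: XL] -/
@[route_item "route-CriticalPhenomena-PercPortalLadder"]
def BoundaryTwoPointDecay : Prop :=
  ∃ s C : ℝ, 1 < s ∧ ∀ y : Literature.Probability.LatticeModels.Site 3, y 0 = 0 → y ≠ 0 → (Literature.Probability.Percolation.bondPercolation (Literature.Probability.LatticeModels.zdGraph 3) (Literature.Probability.Percolation.criticalProbI 3)).real (Literature.Probability.Percolation.openConnIn {z : Literature.Probability.LatticeModels.Site 3 | 0 ≤ z 0} 0 y) ≤ C * (dist y 0) ^ (-s)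

/-- item stmt-CriticalPhenomena-0913 · aside · rank 4 · open · by planner
why it might fail: BGN (Grimmett1999 Thm 7.35) is qualitative ({θ_H>0} open by a finite-size criterion; no rate extractable); no half-space one-arm rate in print, 3≤d≤10 (ChatterjeeHanson2020 r^{-3} needs d≥11; KozmaNitzan2024 p.2); a power law needs a scale-uniform half-space crossing bound <1 at p_c: unknown in 3D.
sources: Grimmett1999, BarskyGrimmettNewman1991, arXiv:1810.03750, ChatterjeeHanson2020, KozmaNitzan2024, NewmanTassionWu2017
[crux] r4 (C): quantitative Barsky-Grimmett-Newman. At p_c(Z^3) the boundary one-arm probability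
P(C_H(0) reaches sup-distance >= r) <= C r^{-a} for SOME a > 0 (numerically a = x_s ~ 0.975,
Deng-Blote 2005). BGN's theta_H(p_c) = 0 (proved in tree: BarskyGrimmettNewman1991_Z3_holds) is
soft, by contradiction through a finite-size criterion; a rate needs a renewal/multi-scale version
of steering. Publishable alone; wanted in spirit by cards counterfactual-cluster-resistance,
boundary-critical-squeeze, climb-ratio-receding-floor-v2, quarantine-fat-islands (which needs a >
4/5). Sources: Grimmett1999 Thm (7.35) pp.162-169; KozmaNitzan2024 p.2 item 4 (no rate for BGN in
print); doi:10.1103/PhysRevE.71.016117. -/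
@[route_item "route-CriticalPhenomena-PercPortalLadder"]
def QuantitativeBGN : Prop :=
  ∃ a C : ℝ, 0 < a ∧ ∀ r : ℕ, 1 ≤ r → (Literature.Probability.Percolation.bondPercolation (Literature.Probability.LatticeModels.zdGraph 3) (Literature.Probability.Percolation.criticalProbI 3)).real {ω | ∃ y : Literature.Probability.LatticeModels.Site 3, (∃ i : Fin 3, (r : ℤ) ≤ |y i|) ∧ ω ∈ Literature.Probability.Percolation.openConnIn {x : Literature.Probability.LatticeModels.Site 3 | 0 ≤ x 0} 0 y} ≤ C * (r : ℝ) ^ (-a)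

/-- item stmt-CriticalPhenomena-14518 · support · rank 9 · closed · proved by Summit.CriticalPhenomena.PercolationContinuityZ3.Theorems.PercPortalLadderPlaneOfPortalGrid.planeOfPortalGrid_proof @ 4e72ed05b746 (prover) · by planner
sources: Grimmett1999, Literature.Probability.Percolation.theta_zdGraph_eq_theta_zero, BarskyGrimmettNewman1991
[support] GLUE cruxes → target (route-choice repair 2026-08-16; clears the gate lint
`route.target-unreachable: no item concludes the target PortalLadder`): PortalGridRung →
GridWallPersistence → PortalLadder, by name. Proof (provable now, Lean size S–M; planner check
Sketch2.lean rc 0 modulo the monotonicity lemma below): if 0 < θ_{ℤ³}(0, p_c), GridWallPersistence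
at the spacing k ≥ 2 ≥ 1 supplied by PortalGridRung gives a vertex w with θ_{G_{Π_k}}(w, p_c) > 0,
contradicting the rung; hence θ_{ℤ³}(0, p_c) = 0 (θ ≥ 0: unfold theta,
MeasureTheory.measureReal_nonneg). Then for every P and v: θ_{G_P}(v, p_c) ≤ θ_{ℤ³}(v, p_c) =
θ_{ℤ³}(0, p_c) = 0 by translation invariance
(Literature.Probability.Percolation.theta_zdGraph_eq_theta_zero, module
Literature.Probability.Percolation.ConnectivityProofs — not in the route file's import cone, import
it in the Theorems file) and monotonicity of θ under deleting edges: E(G_P) ⊆ E(zdGraph 3), the map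
ω ↦ ω ∩ E(G_P) pushes bondPercolation (zdGraph 3) p = setBer(E(ℤ³), p) to setBer(E(G_P), p) =
bondPercolation G_P p (setBernoulli_map_inter in
Literature.Barriers.CriticalPhenomena.TimarCriticalNonunimodular) and percolatesAt v is monotone in
ω (openC -/
@[route_item "route-CriticalPhenomena-PercPortalLadder"]
def PlaneOfPortalGrid : Prop :=
  PortalGridRung → GridWallPersistence → PortalLadder

-- `PlaneOfPortalGrid` holds: proved by `Summit.CriticalPhenomena.PercolationContinuityZ3.Theorems.PercPortalLadderPlaneOfPortalGrid.planeOfPortalGrid_proof` @ 4e72ed05b746 (its module imports this route file, so no `_holds` link can be stated here).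

/-- item stmt-CriticalPhenomena-6260 · support · rank 9 · closed · proved by Summit.CriticalPhenomena.PercolationContinuityZ3.Theorems.PercPortalLadderPortalSumCriterion.portalSumCriterion_proof @ d224704e6d3c (prover) · by planner
sources: vandenBergKestenJAP1985, ReimerCPC2000, BarskyGrimmettNewman1991, Grimmett1999
[support] the cascade lemma in criterion form (card Crux 3, corrected kernel): for P ⊆ {x₀ = 0}, if
sup_{x∈P} Σ_{y∈P∖{x}} τ∂(x,y) ≤ 1/2 (all finite partial sums) then S(P). Proof: BGN at every
boundary point of H⁺ and H⁻ (translation/reflection symmetry) makes all pieces finite ⇒ an infinite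
cluster contains an infinite self-avoiding piece path (König); distinct same-side pieces occur
disjointly (BK by finite approximation), sides and portals independent ⇒ E[# paths of length n] ≤
A_v (p_c/2)^{n−1} → 0. Lean size L. [difficulty: provable-now] -/
@[route_item "route-CriticalPhenomena-PercPortalLadder"]
def PortalSumCriterion : Prop :=
  ∀ P : Set (Literature.Probability.LatticeModels.Site 3), P ⊆ {x | x 0 = 0} → (∀ x ∈ P, ∀ F : Finset (Literature.Probability.LatticeModels.Site 3), (↑F : Set (Literature.Probability.LatticeModels.Site 3)) ⊆ P \ {x} → ∑ y ∈ F, (Literature.Probability.Percolation.bondPercolation (Literature.Probability.LatticeModels.zdGraph 3) (Literature.Probability.Percolation.criticalProbI 3)).real (Literature.Probability.Percolation.openConnIn {z : Literature.Probability.LatticeModels.Site 3 | 0 ≤ z 0} x y) ≤ 1 / 2) → ∀ v : Literature.Probability.LatticeModels.Site 3, Literature.Probability.Percolation.theta ((Literature.Probability.LatticeModels.zdGraph 3).deleteEdges {e | ∃ x : Literature.Probability.LatticeModels.Site 3, x 0 = 0 ∧ x ∉ P ∧ e = s(x, x - Pi.single 0 1)}) v (Literature.Probability.Percolation.criticalProbI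 3) = 0

-- `PortalSumCriterion` holds: proved by `Summit.CriticalPhenomena.PercolationContinuityZ3.Theorems.PercPortalLadderPortalSumCriterion.portalSumCriterion_proof` @ d224704e6d3c (its module imports this route file, so no `_holds` link can be stated here).

/-- item stmt-CriticalPhenomena-6261 · support · rank 9 · closed · proved by Summit.CriticalPhenomena.PercolationContinuityZ3.Theorems.PercPortalLadderFreeRung.freeRung_proof @ d224704e6d3c (prover) · by planner
sources: BarskyGrimmettNewman1991, Grimmett1999, vandenBergKestenJAP1985
[support] the free rung (card): there is an INFINITE portal set P ⊆ {x₀ = 0} with S(P) —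
unconditionally. Proof: τ∂(0, ±n e₁) → 0 (BGN + continuity of measure, the floor analogue of
PercLowPointHalfSpace.HalfSpaceAxisDecay), so a greedy sequence kₙe₁ with fast-growing gaps meets
PortalSumCriterion (row sums ≤ 1/4 + 1/4). The first 'BGN + ε' theorem: two critical half-spaces
glued through infinitely many doors still do not percolate. [difficulty: provable-now] -/
@[route_item "route-CriticalPhenomena-PercPortalLadder"]
def FreeRung : Prop :=
  ∃ P : Set (Literature.Probability.LatticeModels.Site 3), P ⊆ {x | x 0 = 0} ∧ P.Infinite ∧ ∀ v : Literature.Probability.LatticeModels.Site 3, Literature.Probability.Percolation.theta ((Literature.Probability.LatticeModels.zdGraph 3).deleteEdges {e | ∃ x : Literature.Probability.LatticeModels.Site 3, x 0 = 0 ∧ x ∉ P ∧ e = s(x, x - Pi.single 0 1)}) v (Literature.Probability.Percolation.criticalProbI 3) = 0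

-- `FreeRung` holds: proved by `Summit.CriticalPhenomena.PercolationContinuityZ3.Theorems.PercPortalLadderFreeRung.freeRung_proof` @ d224704e6d3c (its module imports this route file, so no `_holds` link can be stated here).

/-- item stmt-CriticalPhenomena-6262 · support · rank 9 · closed · proved by Summit.CriticalPhenomena.PercolationContinuityZ3.Theorems.PercPortalLadderDilatedLineRung.dilatedLineRung_proof @ d224704e6d3c (prover) · by planner
sources: BarskyGrimmettNewman1991, DengBlote2005, vandenBergKestenJAP1985
[support] glue for the line: BoundaryTwoPointDecay ⇒ ∃ k₀, ∀ k ≥ k₀, S(kℤ e₁) (portals above the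
multiples of k on the line): row sums Σ_{j≠0} C|jk|^{−s} = 2Cζ(s)k^{−s} ≤ 1/2 for k ≥ k₀, then
PortalSumCriterion (translation invariance of τ∂ along e₁). [difficulty: provable-now] -/
@[route_item "route-CriticalPhenomena-PercPortalLadder"]
def DilatedLineRung : Prop :=
  (∃ s C : ℝ, 1 < s ∧ ∀ y : Literature.Probability.LatticeModels.Site 3, y 0 = 0 → y ≠ 0 → (Literature.Probability.Percolation.bondPercolation (Literature.Probability.LatticeModels.zdGraph 3) (Literature.Probability.Percolation.criticalProbI 3)).real (Literature.Probability.Percolation.openConnIn {z : Literature.Probability.LatticeModels.Site 3 | 0 ≤ z 0} 0 y) ≤ C * (dist y 0) ^ (-s)) → ∃ k₀ : ℕ, ∀ k : ℕ, k₀ ≤ k → ∀ v : Literature.Probability.LatticeModels.Site 3, Literature.Probability.Percolation.theta ((Literature.Probability.LatticeModels.zdGraph 3).deleteEdges {e | ∃ x : Literature.Probability.LatticeModels.Site 3, x 0 = 0 ∧ x ∉ {y : Literature.Probability.LatticeModels.Site 3 | y 2 = 0 ∧ (k : ℤ) ∣ y 1} ∧ e = s(x, x - Pi.single 0 1)}) v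 (Literature.Probability.Percolation.criticalProbI 3) = 0

-- `DilatedLineRung` holds: proved by `Summit.CriticalPhenomena.PercolationContinuityZ3.Theorems.PercPortalLadderDilatedLineRung.dilatedLineRung_proof` @ d224704e6d3c (its module imports this route file, so no `_holds` link can be stated here).

/-- item stmt-CriticalPhenomena-6263 · support · rank 9 · closed · proved by Summit.CriticalPhenomena.PercolationContinuityZ3.Theorems.PercPortalLadderDimensionRung.dimensionRung_proof @ d224704e6d3c (prover) · by planner
sources: BarskyGrimmettNewman1991, vandenBergKestenJAP1985, ReimerCPC2000, Grimmett1999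
[support] glue for the card's dimension rungs: QuantitativeBGN ⇒ ∃ a, ε > 0 such that every P ⊆ {x₀
= 0} that is a-sparse (sup_{x∈P} Σ_{y∈P∖{x}} |x−y|_∞^{−a} ≤ ε) has S(P). Proof: τ∂(x,y) ≤
P(arm(x,⌊d/2⌋) ∘ arm(y,⌊d/2⌋)) ≤ C² 3^{2a} d^{−2a} by BK (initial and final path segments are
edge-disjoint), then PortalSumCriterion with ε = 1/(2 max(1, C² 9^a)). All portal sets of upper
Minkowski dimension < a qualify after dilation. [difficulty: provable-now] -/
@[route_item "route-CriticalPhenomena-PercPortalLadder"]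
def DimensionRung : Prop :=
  (∃ a C : ℝ, 0 < a ∧ ∀ r : ℕ, 1 ≤ r → (Literature.Probability.Percolation.bondPercolation (Literature.Probability.LatticeModels.zdGraph 3) (Literature.Probability.Percolation.criticalProbI 3)).real {ω | ∃ y : Literature.Probability.LatticeModels.Site 3, (∃ i : Fin 3, (r : ℤ) ≤ |y i|) ∧ ω ∈ Literature.Probability.Percolation.openConnIn {x : Literature.Probability.LatticeModels.Site 3 | 0 ≤ x 0} 0 y} ≤ C * (r : ℝ) ^ (-a)) → ∃ a ε : ℝ, 0 < a ∧ 0 < ε ∧ ∀ P : Set (Literature.Probability.LatticeModels.Site 3), P ⊆ {x | x 0 = 0} → (∀ x ∈ P, ∀ F : Finset (Literature.Probability.LatticeModels.Site 3), (↑F : Set (Literature.Probability.LatticeModels.Site 3)) ⊆ P \ {x} → ∑ y ∈ F, (dist x y) ^ (-a) ≤ ε) → ∀ v : Literature.Probability.LatticeModels.Site 3, Literature.Probability.Percolation.theta ((Literature.Probability.LatticeModels.zdGraph 3).deleteEdges {e | ∃ x : Literature.Probability.LatticeModels.Site 3, x 0 = 0 ∧ x ∉ P ∧ e = s(x, x -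 Pi.single 0 1)}) v (Literature.Probability.Percolation.criticalProbI 3) = 0

-- `DimensionRung` holds: proved by `Summit.CriticalPhenomena.PercolationContinuityZ3.Theorems.PercPortalLadderDimensionRung.dimensionRung_proof` @ d224704e6d3c (its module imports this route file, so no `_holds` link can be stated here).

/-- item stmt-CriticalPhenomena-6264 · assembly · rank 1 · closed · proved by Summit.CriticalPhenomena.PercolationContinuityZ3.Theorems.PercPortalLadderAssembly.assembly_proof @ 4e72ed05b746 (prover) · by planner
sources: BarskyGrimmettNewman1991, Grimmett1999
[assembly] PortalLadder → PercolationContinuityZ3 (instance P = univ, v = 0). -/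
@[route_item "route-CriticalPhenomena-PercPortalLadder"]
def Assembly : Prop :=
  (∀ P : Set (Literature.Probability.LatticeModels.Site 3), ∀ v : Literature.Probability.LatticeModels.Site 3, Literature.Probability.Percolation.theta ((Literature.Probability.LatticeModels.zdGraph 3).deleteEdges {e | ∃ x : Literature.Probability.LatticeModels.Site 3, x 0 = 0 ∧ x ∉ P ∧ e = s(x, x - Pi.single 0 1)}) v (Literature.Probability.Percolation.criticalProbI 3) = 0) → PercolationContinuityZ3

-- `Assembly` holds: proved by `Summit.CriticalPhenomena.PercolationContinuityZ3.Theorems.PercPortalLadderAssembly.assembly_proof` @ 4e72ed05b746 (its module imports this route file, so no `_holds` link can be stated here).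

/-! D-0027 §2.1 — DECIDING THEOREM (planner-authored via `route open/edit --closes-file`; by planner-rchoice-CriticalPhenomena-PercPortalLa-4c059929-0 2026-08-16T03:30:04Z):
its hypotheses are this route's items and its conclusion the sub-problem Statement (glue_lint), and it elaborates with this file. -/

@[closes "route-CriticalPhenomena-PercPortalLadder"] theorem closes (hRung : PortalGridRung) (hWall : GridWallPersistence) (hGlue : PlaneOfPortalGrid) :
    _root_.PercolationContinuityZ3 := by
  -- the target in ladder form (S(P) for every portal set P), obtained from the two top cruxes through the glue item
  have hLadder : PortalLadder := hGlue hRung hWall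
  -- instance P = univ (empty wall: no crossing edge is deleted) and v = 0; `SimpleGraph.deleteEdges_empty` returns `zdGraph 3`
  have hwall : {e : Sym2 (Literature.Probability.LatticeModels.Site 3) | ∃ x : Literature.Probability.LatticeModels.Site 3,
      x 0 = 0 ∧ x ∉ (Set.univ : Set (Literature.Probability.LatticeModels.Site 3)) ∧ e = s(x, x - Pi.single 0 1)} = ∅ := by
    ext e
    simp
  have h := hLadder Set.univ 0
  rw [hwall, SimpleGraph.deleteEdges_empty] at h
  exact h

end Summit.CriticalPhenomena.PercolationContinuityZ3.Theses.PercPortalLadder
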